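import Mathlib
import Literature.MathematicalPhysics.QuantumFieldTheory.Balaban1983to89.B7Prop6Bound
import HarnessLib

/-!
# Route «BalabanUVNodes» (K4 «SpineRates»), node N15 = NE2 — ORDERED PRODUCTS IN A NORMED RING: `oprod F N = F(0)⋯F(N−1)`, splitting and blocks, and the two
# norm lemmas that avoid `‖1‖` (`‖Π − 1‖ ≤ (1+κ)^N − 1`, `‖ΠF − ΠG‖ ≤ (Σ‖F_i − G_i‖)(1+κ)^N` for factors within `κ` of `1`) — the bookkeeping behind the parallel
# transports along the staircase contours of (3.55)–(3.57) (sequel `…N15ContourProducts`)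

Cell `pub-ymgap`, seat `pub-ymgap-dag-n15-c` (generation g4; R134 ACCELERATION SEAT, strategy s1; HUMAN RULING D-0062; chair R424 venue; `bears_on: R4∕N15`).
Filed `--supports stmt-QuantumFields-19908 --as helper` (K3′; helper).  The ordered product itself is the Literature's `B7Prop6Bound.oprod` BY NAME (the products
(160) of [Balaban1985Averaging] Prop. 6 — the very averaging products behind (3.55)–(3.57)); this file adds splitting∕blocks∕telescoping lemmas for it.  WHY: the print's averaging perturbation `F′₂ⱼ(A; y, x)` of
[Balaban1985BackgroundPropagators] (3.55)–(3.58) is an ORDERED product of bond exponentials along a contour; its two-spacing fit is a factorwise telescoping of two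
such products (sequel).  CONTENTS: for `B7Prop6Bound.oprod`: `oprod_zero`, `oprod_succ`, `oprod_congr`, `oprod_add`, `oprod_const`, `oprod_blocks`, **`norm_oprod_sub_one_le`** (constant-`κ`
form of B7's `prod_sub_one_norm_le`), **`norm_oprod_sub_oprod_le`** (telescoping), `norm_mul_sub_self_le`.  RELATED, NOT DUPLICATED: the Literature's `B14Eq372ContourBCH.holonomy` (ordered products of exponentials
in a complete normed `ℂ`-algebra, with a BCH expansion) — a different base field and purpose; not consumable here.

HONEST FRAMING ∕ LIMITS.  [folklore] normed-ring algebra; no estimate of Bałaban's.  Count-neutral (typed 28∕28 · discharged unchanged); NOT a discharge of N15;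
one finite T⁴ at fixed ε — NOT infinite volume, NOT OS on ℝ⁴, NOT a mass gap, NOT Clay.
-/

noncomputable section

open scoped BigOperators
open Finset

namespace Summit.QuantumFields.YangMills.BalabanUVNodes.N15.VectorPiece

open Literature.MathematicalPhysics.QuantumFieldTheory.Balaban1983to89.B7Prop6Bound (oprod)

/-! ## §1 Ordered products in a normed ring (`B7Prop6Bound.oprod F N = F(0)·F(1)⋯F(N−1)`) -/

section OProd

variable {𝔸 : Type} [NormedRing 𝔸]

/-- The empty product. [folklore] -/
@[simp] theorem oprod_zero (F : ℕ → 𝔸) : oprod F 0 = 1 := rfl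

/-- One more factor on the right. [folklore] -/
theorem oprod_succ (F : ℕ → 𝔸) (N : ℕ) : oprod F (N + 1) = oprod F N * F N := rfl

/-- Products of pointwise-equal factor lists agree. [folklore] -/
theorem oprod_congr {F G : ℕ → 𝔸} {N : ℕ} (h : ∀ i < N, F i = G i) : oprod F N = oprod G N := by
  induction N with
  | zero => rfl
  | succ N ih => rw [oprod_succ, oprod_succ, ih (fun i hi => h i (Nat.lt_succ_of_lt hi)), h N (Nat.lt_succ_self N)]

/-- Splitting an ordered product: `Π_{i<N+M} F_i = (Π_{i<N} F_i)·(Π_{i<M} F_{N+i})`. [folklore] -/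
theorem oprod_add (F : ℕ → 𝔸) (N M : ℕ) : oprod F (N + M) = oprod F N * oprod (fun i => F (N + i)) M := by
  induction M with
  | zero => simp
  | succ M ih => rw [Nat.add_succ, oprod_succ, ih, oprod_succ, mul_assoc]

/-- A constant ordered product is a power. [folklore] -/
theorem oprod_const (H : 𝔸) (n : ℕ) : oprod (fun _ => H) n = H ^ n := by
  induction n with
  | zero => simp
  | succ n ih => rw [oprod_succ, ih, pow_succ]

/-- Blocks: `Π_{s<A} Π_{j<B} H(sB + j) = Π_{i<AB} H(i)`. [folklore] -/
theorem oprod_blocks (H : ℕ → 𝔸) (A B : ℕ) : oprod (fun s => oprod (fun j => H (s * B + j)) B) A = oprod H (A * B) := by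
  induction A with
  | zero => simp
  | succ A ih => rw [oprod_succ, ih, Nat.succ_mul, oprod_add]

/-- **`‖Π F − 1‖ ≤ (1+κ)^N − 1`** when every factor has `‖F_i − 1‖ ≤ κ` (no hypothesis on `‖1‖`). [folklore] -/
theorem norm_oprod_sub_one_le {F : ℕ → 𝔸} {κ : ℝ} (hκ : 0 ≤ κ) {N : ℕ} (hF : ∀ i < N, ‖F i - 1‖ ≤ κ) :
    ‖oprod F N - 1‖ ≤ (1 + κ) ^ N - 1 := by
  induction N with
  | zero => simp
  | succ N ih =>
    have hN := ih fun i hi => hF i (Nat.lt_succ_of_lt hi)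
    have hFN := hF N (Nat.lt_succ_self N)
    have hp : 0 ≤ (1 + κ) ^ N - 1 := sub_nonneg.2 (one_le_pow₀ (by linarith))
    have hid : oprod F (N + 1) - 1 = (oprod F N - 1) + (oprod F N - 1) * (F N - 1) + (F N - 1) := by
      rw [oprod_succ]; noncomm_ring
    rw [hid]
    calc ‖(oprod F N - 1) + (oprod F N - 1) * (F N - 1) + (F N - 1)‖
        ≤ ‖oprod F N - 1‖ + ‖oprod F N - 1‖ * ‖F N - 1‖ + ‖F N - 1‖ :=
          (norm_add₃_le).trans (add_le_add (add_le_add le_rfl (norm_mul_le _ _)) le_rfl)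
      _ ≤ ((1 + κ) ^ N - 1) + ((1 + κ) ^ N - 1) * κ + κ :=
          add_le_add (add_le_add hN (mul_le_mul hN hFN (norm_nonneg _) hp)) hFN
      _ = (1 + κ) ^ (N + 1) - 1 := by ring

/-- **TELESCOPING WITHOUT `‖1‖`**: `‖Π F − Π G‖ ≤ (Σ_{i<N} ‖F_i − G_i‖)·(1+κ)^N` when `‖F_i − 1‖, ‖G_i − 1‖ ≤ κ`. [folklore] -/
theorem norm_oprod_sub_oprod_le {F G : ℕ → 𝔸} {κ : ℝ} (hκ : 0 ≤ κ) {N : ℕ} (hF : ∀ i < N, ‖F i - 1‖ ≤ κ) (hG : ∀ i < N, ‖G i - 1‖ ≤ κ) :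
    ‖oprod F N - oprod G N‖ ≤ (∑ i ∈ Finset.range N, ‖F i - G i‖) * (1 + κ) ^ N := by
  induction N with
  | zero => simp
  | succ N ih =>
    have hD := ih (fun i hi => hF i (Nat.lt_succ_of_lt hi)) (fun i hi => hG i (Nat.lt_succ_of_lt hi))
    have hP := norm_oprod_sub_one_le hκ (fun i hi => hF i (Nat.lt_succ_of_lt hi))
    have hGN := hG N (Nat.lt_succ_self N)
    have hS0 : 0 ≤ ∑ i ∈ Finset.range N, ‖F i - G i‖ := Finset.sum_nonneg fun _ _ => norm_nonneg _
    have hk1 : 1 ≤ 1 + κ := by linarith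
    have hpow : 0 ≤ (1 + κ) ^ N := pow_nonneg (by linarith) _
    have hid : oprod F (N + 1) - oprod G (N + 1) =
        (oprod F N - oprod G N) + (oprod F N - oprod G N) * (G N - 1) + (F N - G N) + (oprod F N - 1) * (F N - G N) := by
      rw [oprod_succ, oprod_succ]; noncomm_ring
    rw [hid, Finset.sum_range_succ]
    calc ‖(oprod F N - oprod G N) + (oprod F N - oprod G N) * (G N - 1) + (F N - G N) + (oprod F N - 1) * (F N - G N)‖
        ≤ ‖oprod F N - oprod G N‖ + ‖oprod F N - oprod G N‖ * ‖G N - 1‖ + ‖F N - G N‖ + ‖oprod F N - 1‖ * ‖F N - G N‖ := by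
          refine (norm_add_le _ _).trans (add_le_add ((norm_add₃_le).trans (add_le_add (add_le_add le_rfl (norm_mul_le _ _)) le_rfl)) (norm_mul_le _ _))
      _ ≤ (∑ i ∈ Finset.range N, ‖F i - G i‖) * (1 + κ) ^ N + (∑ i ∈ Finset.range N, ‖F i - G i‖) * (1 + κ) ^ N * κ + ‖F N - G N‖ +
            ((1 + κ) ^ N - 1) * ‖F N - G N‖ :=
          add_le_add (add_le_add (add_le_add hD (mul_le_mul hD hGN (norm_nonneg _) (mul_nonneg hS0 hpow))) le_rfl)
            (mul_le_mul_of_nonneg_right hP (norm_nonneg _))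
      _ = ((∑ i ∈ Finset.range N, ‖F i - G i‖) * (1 + κ) + ‖F N - G N‖) * (1 + κ) ^ N := by ring
      _ ≤ ((∑ i ∈ Finset.range N, ‖F i - G i‖) * (1 + κ) + ‖F N - G N‖ * (1 + κ)) * (1 + κ) ^ N := by
          gcongr; exact le_mul_of_one_le_right (norm_nonneg _) hk1
      _ = (∑ i ∈ Finset.range N, ‖F i - G i‖ + ‖F N - G N‖) * (1 + κ) ^ (N + 1) := by ring

/-- A trailing factor: `‖P·R − P‖ ≤ (1 + ‖P − 1‖)·‖R − 1‖`. [folklore] -/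
theorem norm_mul_sub_self_le (P R : 𝔸) : ‖P * R - P‖ ≤ (1 + ‖P - 1‖) * ‖R - 1‖ := by
  have hid : P * R - P = (R - 1) + (P - 1) * (R - 1) := by noncomm_ring
  rw [hid]
  calc ‖(R - 1) + (P - 1) * (R - 1)‖ ≤ ‖R - 1‖ + ‖P - 1‖ * ‖R - 1‖ := (norm_add_le _ _).trans (add_le_add le_rfl (norm_mul_le _ _))
    _ = (1 + ‖P - 1‖) * ‖R - 1‖ := by ring

end OProd

end Summit.QuantumFields.YangMills.BalabanUVNodes.N15.VectorPiece

end
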